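import Summits.CriticalPhenomena.PercolationContinuityZ3.Theorems.PercNearOneGluingAdditiveGluingK0CovTransferQ
import Summits.CriticalPhenomena.PercolationContinuityZ3.Theorems.PercNearOneGluingAdditiveGluingSetGlueK0Closed
import Summits.CriticalPhenomena.PercolationContinuityZ3.Theorems.PercNearOneGluingAdditiveGluingK0OfCovTransfer
import Summits.CriticalPhenomena.PercolationContinuityZ3.Theorems.PercNearOneGluingAdditiveGluingK0CovTransferPOfQ
import Summits.CriticalPhenomena.PercolationContinuityZ3.Theorems.PercNearOneGluingAdditiveGluingK0AttachTransfer
import Summits.CriticalPhenomena.PercolationContinuityZ3.Theorems.PercNearOneGluingAdditiveGluingK0AttachTransferD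
import HarnessLib

/-!
# Crux `PercNearOneGluing.AdditiveGluing` (stmt-CriticalPhenomena-4576), line `tieline`:
# the pair kernel (K₀) PROVED, and the crux from the single remaining stub (K₀-set)₍≥3₎

Support file (`--supports stmt-CriticalPhenomena-4576`; seat (d) exchange-certificate form, gen 12).  No definitions, no named
facts, no sorries.

With the kernel (T) = `stub_k0CovTransferQ_c9` landed (`…AdditiveGluingK0CovTransferQ.lean`, p205120: UCT bridge + the unconditional
marker dominance lemma `CovTau.markerDominanceAvoid`), every input of the lead's pair chain is an accepted theorem:
(γ) `stub_k0AttachTransfer_c9`, (γ'') `stub_k0AttachTransferD_c10`, (β) = (T) `stub_k0CovTransferQ_c9`,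
(α) = `k0CovTransferP_of_Q` (β)+(γ''), and (K₀) = `k0_of_covTransfer` (γ)(α)(β).  This file records:

* `k0_pair` — **the slack-inheritance kernel (K₀) for two relays, unconditionally** (the registered `stub_k0_dp` of the earlier
  skeletons; Kozma–Nitzan's Question 7 shape): for relays `a₁, a₂` with `τ_{a₂} ≤ τ_{a₁}`, spectator `c`, observer `o`, target `b`,
  `μ(N ∩ o↔c)·(M − G_c) ≤ μ(N)·(M − G_o)`, `N = {c↮a₁}∩{c↮a₂}`, `M = μ(a₁↔b ∪ a₂↔b) − τ_{a₂}`,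
  `G_x = μ(x↮b ∩ (x↔a₁ ∪ x↔a₂) ∩ (a₁↔b ∪ a₂↔b))`.
* `additiveGluing_of_k0set3` — **THE ONE-HYPOTHESIS SOCKET of line `tieline`**: `AdditiveGluing` from the set-gluing kernel (K₀-set)
  for glued sets of size `≥ 3` alone (= the registered stub `stub_k0set3_g2`, hypothesis verbatim), via `additiveGluing_of_k0_k0set3`.
[cite: KozmaNitzan2024, Conjecture 1 (p. 3), Lemma 4 (p. 9), Question 7 (p. 36), §5.3 (p. 34)]
[cite: VandenbergHaggstromKahn2005, Thms. 1.3–1.5 (pp. 6–8), §2.1 (pp. 9–13)] [cite: Gladkov2024, Thm. 3.2]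
-/

namespace Summit.CriticalPhenomena.PercolationContinuityZ3.Cruxes.AdditiveGluing.TieLine

open MeasureTheory Set Literature.Probability.LatticeModels Literature.Probability.Percolation
open Summit.CriticalPhenomena.PercolationContinuityZ3.Theorems

noncomputable section

/-- **(K₀), the slack-inheritance kernel for a pair of relays — PROVED.**  For `τ_{a₂} ≤ τ_{a₁}`:
`μ(N ∩ o↔c)·(M − G_c) ≤ μ(N)·(M − G_o)` (notation of the file header).  `k0_of_covTransfer` fed with the landed (γ), (α) ⟸ (β)+(γ''),
and (β) = (T). [cite: KozmaNitzan2024, Lemma 4 (p. 9), Question 7 (p. 36)] [cite: VandenbergHaggstromKahn2005, Thm. 1.5 (p. 7), §2.1] -/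
theorem k0_pair : ∀ (n : ℕ) (w : Sym2 (Fin n) → unitInterval) (o b a₁ a₂ c : Fin n),
    (prodBernoulli w).real (openConn a₂ b) ≤ (prodBernoulli w).real (openConn a₁ b) →
    (prodBernoulli w).real ((openConn c a₁)ᶜ ∩ (openConn c a₂)ᶜ ∩ openConn o c) *
        ((prodBernoulli w).real (openConn a₁ b ∪ openConn a₂ b) - (prodBernoulli w).real (openConn a₂ b) -
          (prodBernoulli w).real ((openConn c b)ᶜ ∩ (openConn c a₁ ∪ openConn c a₂) ∩ (openConn a₁ b ∪ openConn a₂ b))) ≤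
      (prodBernoulli w).real ((openConn c a₁)ᶜ ∩ (openConn c a₂)ᶜ : Set (BondConfig (Fin n))) *
        ((prodBernoulli w).real (openConn a₁ b ∪ openConn a₂ b) - (prodBernoulli w).real (openConn a₂ b) -
          (prodBernoulli w).real ((openConn o b)ᶜ ∩ (openConn o a₁ ∪ openConn o a₂) ∩ (openConn a₁ b ∪ openConn a₂ b))) :=
  k0_of_covTransfer stub_k0AttachTransfer_c9 (k0CovTransferP_of_Q stub_k0CovTransferQ_c9 stub_k0AttachTransferD_c10)
    stub_k0CovTransferQ_c9

/-- **`AdditiveGluing` from (K₀-set) for `|S| ≥ 3` alone** (the registered stub `stub_k0set3_g2`, verbatim as hypothesis):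
`additiveGluing_of_k0_k0set3` with its first input (K₀) discharged by `k0_pair`.  The composition `additiveGluing_closed` of the
skeleton `Cruxes/AdditiveGluing/Lines/tieline.lean` with the (T)-stub removed.
[cite: KozmaNitzan2024, Conjecture 1 (p. 3), Theorem 1 (pp. 7–8), Lemma 4 (p. 9), §5.3 (p. 34)] -/
theorem additiveGluing_of_k0set3
    (hK3 : ∀ (n : ℕ) (w : Sym2 (Fin n) → unitInterval) (S : Finset (Fin n)) (o b c s₀ : Fin n), 3 ≤ S.card → s₀ ∈ S → c ∉ S →
      (∀ s ∈ S, (prodBernoulli w).real (openConn s₀ b) ≤ (prodBernoulli w).real (openConn s b)) →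
      (prodBernoulli w).real ((⋃ s ∈ S, (openConn c s : Set (BondConfig (Fin n))))ᶜ ∩ openConn o c) *
          ((prodBernoulli w).real (⋃ s ∈ S, (openConn s b : Set (BondConfig (Fin n)))) -
            (prodBernoulli w).real (openConn s₀ b) -
            (prodBernoulli w).real ((openConn c b)ᶜ ∩ (⋃ s ∈ S, (openConn c s : Set (BondConfig (Fin n)))) ∩
              (⋃ s ∈ S, (openConn s b : Set (BondConfig (Fin n)))))) ≤
        (prodBernoulli w).real ((⋃ s ∈ S, (openConn c s : Set (BondConfig (Fin n))))ᶜ) *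
          ((prodBernoulli w).real (⋃ s ∈ S, (openConn s b : Set (BondConfig (Fin n)))) -
            (prodBernoulli w).real (openConn s₀ b) -
            (prodBernoulli w).real ((openConn o b)ᶜ ∩ (⋃ s ∈ S, (openConn o s : Set (BondConfig (Fin n)))) ∩
              (⋃ s ∈ S, (openConn s b : Set (BondConfig (Fin n))))))) :
    Summit.CriticalPhenomena.PercolationContinuityZ3.Theses.PercNearOneGluing.AdditiveGluing :=
  additiveGluing_of_k0_k0set3 k0_pair hK3

end

end Summit.CriticalPhenomena.PercolationContinuityZ3.Cruxes.AdditiveGluing.TieLine
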